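import Literature.Analysis.Calculus.HadamardSndParam
import Literature.Topology.FourManifolds.MorseLemma
import HarnessLib

/-!
# The fibrewise Morse lemma: Morse coordinates depending smoothly on a parameter

Topic `Literature/Topology/FourManifolds` (towards fold charts at generic indefinite fold
points; Step B–C of the parametric Morse lemma with `k` fibre variables, cf.
`SuspendedFamilyFoldChart.lean` for `k = 1`).  Let `g : ℝ × ℝᵏ → ℝ` be a `C^∞` family of
functions of `u ∈ ℝᵏ` with the zero section critical: `g (t, 0) = 0` and `∂ᵤ g (t, 0) = 0`
for all `t`, and with nondegenerate fibre Hessian `H = ∂ᵤ∂ᵤ g (t₀, 0)` at one parameter `t₀`.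
Then near `(t₀, 0)` there are fibre coordinates `y (t, u) ∈ ℝᵏ`, `C^∞` in `(t, u)`, with
`y (t, 0) = 0`, `∂ᵤ y (t₀, 0)` invertible, and
`g (t, u) = -y₀² - ⋯ - y_{σ-1}² + y_σ² + ⋯ + y_{k-1}²`, `σ` the index of `H`
(`exists_fibrewiseMorseCoords`).  Proof (Hirsch, *Differential Topology*, Ch. 6 §1, proof of
Thm. 1.1, run with a parameter): `g (t, u) = B(t, u)(u, u)` with the smooth symmetric fibre
Hadamard form `B` (`Literature.Analysis.Calculus.fibreHadamardSnd`, `HadamardSndParam.lean`),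
`B(t₀, 0) = ½ H`; Hirsch's lemma
(`Literature.Topology.FourManifolds.exists_contDiffOn_bilinearComp_eq`) gives `P` smooth near
`B₀ = B(t₀, 0)` with `B(u, v) = B₀(P(B) u, P(B) v)`, so `θ (t, u) = P(B(t, u)) u` satisfies
`g = B₀(θ, θ)`, and sorted Sylvester coordinates `Λ` of `B₀`
(`Literature.Topology.FourManifolds.exists_continuousLinearEquiv_eq_sum_sq`) give `y = Λ ∘ θ`.
Everything is PROVED; no named fact.

## References

* M. W. Hirsch, *Differential Topology* (1976), Ch. 6 §1, Thm. 1.1 and Lemma p. 145.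
  [HirschDT1976]
* R. İ. Baykur, O. Saeki, *Simplifying indefinite fibrations on 4-manifolds*, arXiv:1705.11169,
  §2.1 (real normal form of a fold). [BaykurSaeki2017]
-/

noncomputable section

-- Instance search through the tower `E →L[ℝ] E →L[ℝ] ℝ` needs one more level of pending depth,
-- as in `MorseLemma.lean` and `HadamardLemma.lean`.
set_option maxSynthPendingDepth 2

open Set Function Filter Module
open scoped Topology ContDiff

namespace Literature.Topology.FourManifolds

/-- Local notation: `𝔼 n` is the model Euclidean space `EuclideanSpace ℝ (Fin n)`. -/
local notation "𝔼 " n:arg => EuclideanSpace ℝ (Fin n)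

variable {k : ℕ}

/-! ### The fibre Hessian -/

/-- **The fibre Hessian** of `g : ℝ × ℝᵏ → ℝ` at `x`: the continuous bilinear form
`(a, b) ↦ D²g(x) (0, a) (0, b)` on `ℝᵏ`. [folklore] -/
def fibreHessian (g : ℝ × 𝔼 k → ℝ) (x : ℝ × 𝔼 k) : 𝔼 k →L[ℝ] 𝔼 k →L[ℝ] ℝ :=
  (fderiv ℝ (fderiv ℝ g) x).bilinearComp (ContinuousLinearMap.inr ℝ ℝ (𝔼 k))
    (ContinuousLinearMap.inr ℝ ℝ (𝔼 k))

/-- `fibreHessian g x a b = D²g(x) (0, a) (0, b)`. [folklore] -/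
@[simp] theorem fibreHessian_apply (g : ℝ × 𝔼 k → ℝ) (x : ℝ × 𝔼 k) (a b : 𝔼 k) :
    fibreHessian g x a b = fderiv ℝ (fderiv ℝ g) x ((0 : ℝ), a) ((0 : ℝ), b) := by
  simp [fibreHessian]

/-! ### Fibrewise Morse coordinates -/

/-- **The fibrewise Morse lemma.**  Let `g : ℝ × ℝᵏ → ℝ` be `C^∞` with `g (t, 0) = 0` and
`∂ᵤ g (t, 0) = 0` for all `t` (the zero section is critical), and let the fibre Hessian
`fibreHessian g (t₀, 0)` be nondegenerate, of negative index of inertia `σ`.  Then there are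
an open `W ∋ (t₀, 0)`, a map `y : W → ℝᵏ`, `C^∞` on `W`, and a linear automorphism `Λ` of `ℝᵏ`
with `y (t, 0) = 0`, `∂ᵤ y (t₀, 0) = Λ`, and
`g (t, u) = -(y₀² + ⋯ + y_{σ-1}²) + (y_σ² + ⋯ + y_{k-1}²)` on `W` (the sums over the
coordinates `i < σ` and `σ ≤ i` of `y (t, u)`).
[cite: HirschDT1976, Ch. 6 §1, Thm. 1.1 (proof, pp. 145–146)] -/
theorem exists_fibrewiseMorseCoords {g : ℝ × 𝔼 k → ℝ} (hg : ContDiff ℝ ∞ g)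
    (h0 : ∀ t, g (t, 0) = 0) (h1 : ∀ (t : ℝ) (a : 𝔼 k), fderiv ℝ g (t, 0) ((0 : ℝ), a) = 0)
    {t₀ : ℝ} (hH : ∀ a : 𝔼 k, (∀ b, fibreHessian g (t₀, 0) a b = 0) → a = 0) :
    ∃ (W : Set (ℝ × 𝔼 k)) (y : ℝ × 𝔼 k → 𝔼 k) (Λ : 𝔼 k ≃L[ℝ] 𝔼 k),
      IsOpen W ∧ ((t₀, (0 : 𝔼 k)) : ℝ × 𝔼 k) ∈ W ∧ ContDiffOn ℝ ∞ y W ∧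
      (∀ t : ℝ, ((t, (0 : 𝔼 k)) : ℝ × 𝔼 k) ∈ W → y (t, 0) = 0) ∧
      HasFDerivAt (fun u : 𝔼 k => y (t₀, u)) (Λ : 𝔼 k →L[ℝ] 𝔼 k) 0 ∧
      ∀ p ∈ W, g p =
        - ∑ i ∈ Finset.univ.filter (fun i : Fin k =>
              i.val < sigNeg ((fibreHessian g (t₀, 0)).toBilinForm).toQuadraticMap), (y p i) ^ 2
        + ∑ i ∈ Finset.univ.filter (fun i : Fin k =>
              sigNeg ((fibreHessian g (t₀, 0)).toBilinForm).toQuadraticMap ≤ i.val),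
            (y p i) ^ 2 := by
  have h2 : (2 : WithTop ℕ∞) ≤ ∞ := WithTop.coe_le_coe.2 le_top
  -- the fibre Hadamard form `B`: smooth, symmetric, `g (t, u) = B (t, u) u u`, `B₀ = ½ H`
  set B : ℝ × 𝔼 k → (𝔼 k →L[ℝ] 𝔼 k →L[ℝ] ℝ) :=
    Literature.Analysis.Calculus.fibreHadamardSnd g with hB
  have hBs : ContDiff ℝ ∞ B := Literature.Analysis.Calculus.contDiff_fibreHadamardSnd hg
  have hBsymm : ∀ (p : ℝ × 𝔼 k) (u v : 𝔼 k), B p u v = B p v u := fun p u v => by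
    obtain ⟨t, w⟩ := p
    exact Literature.Analysis.Calculus.fibreHadamardSnd_symm hg h2 t w u v
  have hgB : ∀ p : ℝ × 𝔼 k, g p = B p p.2 p.2 := fun p => by
    obtain ⟨t, u⟩ := p
    exact Literature.Analysis.Calculus.eq_fibreHadamardSnd_of_isCritical hg h2 (h0 t) (h1 t) u
  set B₀ : 𝔼 k →L[ℝ] 𝔼 k →L[ℝ] ℝ := B (t₀, 0) with hB₀
  have hB₀H : B₀ = (2⁻¹ : ℝ) • fibreHessian g (t₀, 0) := by
    ext a b
    rw [hB₀, hB, Literature.Analysis.Calculus.fibreHadamardSnd_apply_zero]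
    simp
  have hB₀symm : ∀ u v, B₀ u v = B₀ v u := hBsymm _
  have hB₀nd : ∀ u, (∀ v, B₀ u v = 0) → u = 0 := by
    intro u hu
    refine hH u fun v => ?_
    have := hu v
    rw [hB₀H] at this
    simpa using this
  -- Hirsch's lemma and sorted Sylvester coordinates for `B₀`
  obtain ⟨N, P, hNo, hB₀N, hPs, hPB₀, hPeq⟩ := exists_contDiffOn_bilinearComp_eq B₀ hB₀symm hB₀nd
  obtain ⟨Λ, hΛ⟩ := exists_continuousLinearEquiv_eq_sum_sq B₀ hB₀symm hB₀nd (n := k)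
    finrank_euclideanSpace_fin
  have hσ : sigNeg ((B₀.toBilinForm).toQuadraticMap) =
      sigNeg (((fibreHessian g (t₀, 0)).toBilinForm).toQuadraticMap) := by
    rw [hB₀H, toQuadraticMap_toBilinForm_smul, sigNeg_smul_of_pos _ (by norm_num)]
  -- `W`, `θ`, `y`
  set W : Set (ℝ × 𝔼 k) := B ⁻¹' N with hW
  have hWo : IsOpen W := hNo.preimage hBs.continuous
  have hW₀ : ((t₀, (0 : 𝔼 k)) : ℝ × 𝔼 k) ∈ W := hB₀N
  set θ : ℝ × 𝔼 k → 𝔼 k := fun p => P (B p) p.2 with hθ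
  set y : ℝ × 𝔼 k → 𝔼 k := fun p => Λ (θ p) with hy
  have hPB : ContDiffOn ℝ ∞ (fun p => P (B p)) W := hPs.comp hBs.contDiffOn fun p hp => hp
  have hθs : ContDiffOn ℝ ∞ θ W := hPB.clm_apply contDiffOn_snd
  have hys : ContDiffOn ℝ ∞ y W := Λ.contDiff.comp_contDiffOn hθs
  refine ⟨W, y, Λ, hWo, hW₀, hys, ?_, ?_, ?_⟩
  · intro t _
    simp [hy, hθ]
  · -- `∂ᵤ θ (t₀, 0) = P B₀ = 1`, hence `∂ᵤ y (t₀, 0) = Λ`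
    have hc : DifferentiableAt ℝ (fun u : 𝔼 k => P (B (t₀, u))) 0 := by
      have h : ContDiffAt ℝ ∞ (fun u : 𝔼 k => P (B (t₀, u))) 0 :=
        (hPB.contDiffAt (hWo.mem_nhds hW₀)).comp 0 (contDiff_prodMk_right t₀).contDiffAt
      exact h.differentiableAt (by simp)
    have hθd : HasFDerivAt (fun u : 𝔼 k => θ (t₀, u)) (ContinuousLinearMap.id ℝ (𝔼 k)) 0 := by
      have h := hc.hasFDerivAt.clm_apply (hasFDerivAt_id (0 : 𝔼 k))
      refine h.congr_fderiv ?_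
      ext v
      simp [← hB₀, hPB₀]
    have hyd := (Λ : 𝔼 k →L[ℝ] 𝔼 k).hasFDerivAt.comp (0 : 𝔼 k) hθd
    exact hyd.congr_fderiv (by ext v; simp)
  · intro p hp
    have hpeq : g p = B₀ (θ p) (θ p) := by
      rw [hgB p]
      exact (hPeq (B p) hp (hBsymm p) p.2 p.2).symm
    rw [hpeq, hΛ (θ p), ← hσ]

end Literature.Topology.FourManifolds

end
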